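import Literature.NumberTheory.Transcendental.FiniteVolumeElementary
import HarnessLib

/-!
# Yoshinaga's two facts from the volumes of finite-volume semialgebraic sets

Both named facts of `PeriodConjecture.lean` attached to Yoshinaga's theorem [Yoshinaga 2008,
arXiv:0805.0349, Thm. 18 / Thm. 1.1] — `isComputableReal_of_isRealPeriod` (real periods are
computable) and `isElementaryReal_of_isRealPeriod` (real periods are elementary) — reduce to a
statement about *sets*: by "the integral is the area under the graph" [Kontsevich–Zagier 2001,
§1.1] every real period is `vol(E₊) − vol(E₋)` for two `ℚ`-semialgebraic sets `E± ⊆ ℝ^{n+1}` of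
*finite volume* (`KZ.IntegralRep.exists_value_eq_volume_sub`, proved in
`FiniteVolumeElementary.lean` from Tarski–Seidenberg and Tonelli).  This file records the
resulting interface, with the set-theoretic input as an explicit hypothesis and in the weakest
form the assembly needs — *the volume of every finite-volume `ℚ`-semialgebraic set is a computable
(resp. elementary) real* — so that any proof of that input (through polynomial tail decay,
`SemialgVolume.isComputableReal_volume_of_tailDecay` / `Yoshinaga.isElementaryReal_volume_of_tailDecay`,
for the set itself or for any `ℚ`-semialgebraic set of the same volume, e.g. a monotone
rearrangement of it; or through a reduction to bounded sets) closes both facts in one line.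
No definition and no named fact is introduced.

## Main statements

* `KZ.IntegralRep.isComputableReal_value_of_volume`,
  `KZ.IntegralRep.isElementaryReal_value_of_volume` — the value of an integral representation is
  computable (elementary) if finite `ℚ`-semialgebraic volumes are.
* `isComputableReal_of_isRealPeriod_of_volume`, `isElementaryReal_of_isRealPeriod_of_volume`,
  `isComputableComplex_of_isPeriod_of_volume` — the named facts of `PeriodConjecture.lean` from
  the same hypothesis.

## References

* M. Yoshinaga, *Periods and elementary real numbers*, arXiv:0805.0349 (2008), Thm. 18, Lemma 24.
* M. Kontsevich, D. Zagier, *Periods*, in: Mathematics Unlimited — 2001 and Beyond, Springer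
  (2001), 771–808, §1.1.
* K. Tent, M. Ziegler, *Computable functions of reals*, Münster J. Math. 3 (2010), 43–66, Cor. 6.4.
-/

noncomputable section

open MeasureTheory
open Literature.Computability.Complexity Literature.ModelTheory.ExponentialFields

namespace Literature.NumberTheory.Transcendental

namespace KZ.IntegralRep

variable {n : ℕ}

/-- **Integral representations are computable if finite semialgebraic volumes are.** If the
volume of every `ℚ`-semialgebraic set of finite volume is a computable real, then the value
`∫_σ f` of every integral representation of the KZ calculus (unbounded domain and integrand
allowed) is a computable real: `∫_σ f = vol(E₊) − vol(E₋)` with `E±` the strict subgraphs of `f^±`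
(`exists_value_eq_volume_sub`), and computable reals are closed under subtraction.
[cite: KontsevichZagier2001, §1.1] -/
theorem isComputableReal_value_of_volume (r : IntegralRep n)
    (H : ∀ (m : ℕ) (E : Set (Fin m → ℝ)), IsSemialgebraic ℚ E → volume E ≠ ⊤ →
      IsComputableReal (volume E).toReal) :
    IsComputableReal r.value := by
  obtain ⟨E₁, E₂, h₁, h₂, f₁, f₂, hval⟩ := r.exists_value_eq_volume_sub
  rw [hval]
  exact (H _ E₁ h₁ f₁).sub (H _ E₂ h₂ f₂)

/-- **Integral representations are elementary if finite semialgebraic volumes are.** If the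
volume of every `ℚ`-semialgebraic set of finite volume is an elementary real, then the value of
every integral representation of the KZ calculus is an elementary real (same decomposition,
closure of the elementary reals under subtraction, Yoshinaga 2008, Prop. 10).
[cite: Yoshinaga2008, Thm. 18] -/
theorem isElementaryReal_value_of_volume (r : IntegralRep n)
    (H : ∀ (m : ℕ) (E : Set (Fin m → ℝ)), IsSemialgebraic ℚ E → volume E ≠ ⊤ →
      IsElementaryReal (volume E).toReal) :
    IsElementaryReal r.value := by
  obtain ⟨E₁, E₂, h₁, h₂, f₁, f₂, hval⟩ := r.exists_value_eq_volume_sub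
  rw [hval]
  exact (H _ E₁ h₁ f₁).sub (H _ E₂ h₂ f₂)

end KZ.IntegralRep

/-- **Real periods are computable if finite semialgebraic volumes are** — the named fact
`isComputableReal_of_isRealPeriod` [Yoshinaga 2008, Thm. 18, computability half of Thm. 1.1] from
the hypothesis that `vol E` is a computable real for every `ℚ`-semialgebraic `E ⊆ ℝ^m` of finite
volume (a real period is the value of a rational integral representation,
`KZ.IntegralRep.isComputableReal_value_of_volume`). [cite: Yoshinaga2008, Thm. 18] -/
theorem isComputableReal_of_isRealPeriod_of_volume
    (H : ∀ (m : ℕ) (E : Set (Fin m → ℝ)), IsSemialgebraic ℚ E → volume E ≠ ⊤ →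
      IsComputableReal (volume E).toReal) :
    isComputableReal_of_isRealPeriod := by
  intro x hx
  obtain ⟨n, σ, p, q, hσ, hq, hint, rfl⟩ := hx
  have := (KZ.IntegralRep.ofRational σ p q hσ hq hint).isComputableReal_value_of_volume H
  rwa [KZ.IntegralRep.value_ofRational] at this

/-- **Real periods are elementary if finite semialgebraic volumes are** — the named fact
`isElementaryReal_of_isRealPeriod` [Yoshinaga 2008, Thm. 18] from the hypothesis that `vol E` is
an elementary real for every `ℚ`-semialgebraic `E ⊆ ℝ^m` of finite volume
(`KZ.IntegralRep.isElementaryReal_value_of_volume`). [cite: Yoshinaga2008, Thm. 18] -/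
theorem isElementaryReal_of_isRealPeriod_of_volume
    (H : ∀ (m : ℕ) (E : Set (Fin m → ℝ)), IsSemialgebraic ℚ E → volume E ≠ ⊤ →
      IsElementaryReal (volume E).toReal) :
    isElementaryReal_of_isRealPeriod := by
  intro x hx
  obtain ⟨n, σ, p, q, hσ, hq, hint, rfl⟩ := hx
  have := (KZ.IntegralRep.ofRational σ p q hσ hq hint).isElementaryReal_value_of_volume H
  rwa [KZ.IntegralRep.value_ofRational] at this

/-- **Periods are computable complex numbers if finite semialgebraic volumes are computable**
(complex form: a period has real periods as real and imaginary parts).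
[cite: Yoshinaga2008, Thm. 18 complex form] -/
theorem isComputableComplex_of_isPeriod_of_volume
    (H : ∀ (m : ℕ) (E : Set (Fin m → ℝ)), IsSemialgebraic ℚ E → volume E ≠ ⊤ →
      IsComputableReal (volume E).toReal) :
    isComputableComplex_of_isPeriod := by
  intro z hz
  exact ⟨isComputableReal_of_isRealPeriod_of_volume H hz.1,
    isComputableReal_of_isRealPeriod_of_volume H hz.2⟩

/-- Under the elementary form of the hypothesis both Yoshinaga facts hold (the computable one
through `IsElementaryReal.isComputableReal_holds`, Tent–Ziegler 2010).
[cite: Yoshinaga2008, Thm. 18] -/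
theorem isElementaryReal_and_isComputableReal_of_isRealPeriod_of_volume
    (H : ∀ (m : ℕ) (E : Set (Fin m → ℝ)), IsSemialgebraic ℚ E → volume E ≠ ⊤ →
      IsElementaryReal (volume E).toReal) :
    isElementaryReal_of_isRealPeriod ∧ isComputableReal_of_isRealPeriod :=
  ⟨isElementaryReal_of_isRealPeriod_of_volume H, fun hx =>
    IsElementaryReal.isComputableReal_holds (isElementaryReal_of_isRealPeriod_of_volume H hx)⟩

end Literature.NumberTheory.Transcendental
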